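import Literature.Geometry.Riemannian.CutLocusBuchnerReduction
import Literature.Geometry.Riemannian.CutLocusClosedHolds
import Literature.Geometry.Manifold.SubanalyticTransfer
import HarnessLib

/-!
# Buchner's theorem from its theory-sized inputs, II: intrinsic subanalyticity of the cut locus

Sequel to `CutLocusBuchnerReduction.lean` (programme towards the named fact
`Literature.Geometry.Riemannian.buchner1977_cutLocus_triangulable` of `CutLocus.lean`; M. A. Buchner,
*Simplicial structure of the real analytic cut locus*, Proc. AMS 64 (1977) 118–121). That file
proved `(S) ∧ (T) ⇒ buchner1977_cutLocus_triangulable` with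
(T) Hironaka's subanalytic triangulation theorem (1975, §3) and (S) "the cut locus is closed and its
image under some continuous injection `M → ℝᴺ` is subanalytic". Two of the three components of (S)
are now theorems of the tree, and this file removes them from the hypotheses:

* closedness of the cut locus — `isClosed_cutLocus_of_compactSpace` (`CutLocusClosedHolds.lean`,
  Lee 2018, Thm. 10.34 (a), through Jacobi fields and the index form);
* the passage from "subanalytic in the analytic manifold `M`" (what Buchner proves, p. 121) to
  "subanalytic in `ℝᴺ`" along an injective analytic map — `IsManifoldSubanalytic.isSubanalytic_image`
  (`SubanalyticTransfer.lean`).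

Results:

* `buchner1977_cutLocus_triangulable_of_subanalytic_image` — (T) and (S') "some continuous
  injection `ι : M → ℝᴺ` makes `ι(cutLocus p)` subanalytic" imply the fact;
* `buchner1977_cutLocus_triangulable_of_manifoldSubanalytic` — (T), (G) "every compact connected
  real-analytic manifold admits an injective real-analytic map into some `ℝᴺ`" (a weak form of the
  Grauert–Morrey analytic embedding theorem, H. Grauert, Ann. of Math. 68 (1958); C. B. Morrey,
  Ann. of Math. 68 (1958)) and (S'') "the cut locus of a point of a compact connected real-analytic
  Riemannian manifold is a subanalytic subset of `M`" (Buchner 1977, pp. 119–121: Milnor's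
  broken-geodesic approximation, `C(p) = {degenerate minimum} ∪ {two minima}`, Hironaka's calculus)
  imply the fact. (T), (G), (S'') are the three classical theorems of real-analytic geometry on
  which Buchner's four pages rest; none is in the tree, none is vendored here (D-0026), each enters
  as an explicit hypothesis in the tree's vocabulary (`IsSubanalytic`, `IsManifoldSubanalytic`,
  `ContMDiff I 𝓘(ℝ, ℝᴺ) ω`).

## References

* [Buchner1977Simplicial] M. A. Buchner, Proc. AMS 64 (1977), pp. 118–121.
* [Hironaka1975] H. Hironaka, Triangulations of algebraic sets, PSPM 29 (1975), §3, Theorem.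
* [LeeRiemannianManifolds2018] J. M. Lee, Introduction to Riemannian Manifolds (2018), Thm. 10.34 (a).
-/

noncomputable section

open Set Function
open scoped Manifold ContDiff Topology

namespace Literature.Geometry.Riemannian

open Literature.Geometry.Lorentzian (PseudoRiemannianMetric)
open Literature.Geometry.Manifold (IsSubanalytic IsManifoldSubanalytic)

universe u v w

/-- **Buchner's theorem from (T) Hironaka's triangulation theorem and (S') the subanalyticity of
an injective continuous image of the cut locus** — `buchner1977_cutLocus_triangulable_of_subanalytic`
with the closedness hypothesis discharged by `isClosed_cutLocus_of_compactSpace` (Lee 2018,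
Thm. 10.34 (a)). [cite: Buchner1977Simplicial, p. 121] -/
theorem buchner1977_cutLocus_triangulable_of_subanalytic_image
    (hT : ∀ (N : ℕ) (X : Set (Fin N → ℝ)), IsSubanalytic X → IsCompact X →
      ∃ (n : ℕ) (K : Geometry.SimplicialComplex ℝ (Fin n → ℝ)),
        K.faces.Finite ∧ Nonempty (X ≃ₜ K.space))
    (hS : ∀ {E : Type u} [NormedAddCommGroup E] [NormedSpace ℝ E] [FiniteDimensional ℝ E]
      {H : Type v} [TopologicalSpace H] (I : ModelWithCorners ℝ E H) [I.Boundaryless]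
      {M : Type w} [TopologicalSpace M] [ChartedSpace H M] [IsManifold I ω M]
      [CompactSpace M] [T2Space M] [ConnectedSpace M]
      (g : PseudoRiemannianMetric I ω E (TangentSpace I : M → Type _)) (hg : g.IsRiemannian)
      (p : M), ∃ (N : ℕ) (ι : M → (Fin N → ℝ)),
        Continuous ι ∧ Injective ι ∧ IsSubanalytic (ι '' cutLocus g hg p)) :
    buchner1977_cutLocus_triangulable.{u, v, w} := by
  refine buchner1977_cutLocus_triangulable_of_subanalytic hT ?_
  intro E _ _ _ H _ I _ M _ _ _ _ _ _ g hg p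
  haveI : BoundarylessManifold I M := inferInstance
  exact ⟨isClosed_cutLocus_of_compactSpace g le_top hg p, hS I g hg p⟩

/-- **Buchner's theorem from the three classical theorems it rests on**: (T) Hironaka's subanalytic
triangulation theorem (every compact subanalytic subset of `ℝᴺ` is homeomorphic to the polyhedron
of a finite simplicial complex; Hironaka 1975, §3), (G) every compact connected Hausdorff
boundaryless real-analytic manifold admits an injective real-analytic map into some `ℝᴺ`
(Grauert–Morrey 1958, weak form), and (S'') the cut locus of a point of a compact connected
real-analytic Riemannian manifold is a subanalytic subset of the manifold (Buchner 1977,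
pp. 119–121). Proof: the cut locus is closed (`isClosed_cutLocus_of_compactSpace`), its image under
the map of (G) is subanalytic in `ℝᴺ` (`IsManifoldSubanalytic.isSubanalytic_image`), and
`buchner1977_cutLocus_triangulable_of_subanalytic_image` applies.
[cite: Buchner1977Simplicial, p. 121] -/
theorem buchner1977_cutLocus_triangulable_of_manifoldSubanalytic
    (hT : ∀ (N : ℕ) (X : Set (Fin N → ℝ)), IsSubanalytic X → IsCompact X →
      ∃ (n : ℕ) (K : Geometry.SimplicialComplex ℝ (Fin n → ℝ)),
        K.faces.Finite ∧ Nonempty (X ≃ₜ K.space))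
    (hG : ∀ {E : Type u} [NormedAddCommGroup E] [NormedSpace ℝ E] [FiniteDimensional ℝ E]
      {H : Type v} [TopologicalSpace H] (I : ModelWithCorners ℝ E H) [I.Boundaryless]
      (M : Type w) [TopologicalSpace M] [ChartedSpace H M] [IsManifold I ω M]
      [CompactSpace M] [T2Space M] [ConnectedSpace M],
      ∃ (N : ℕ) (ι : M → (Fin N → ℝ)), ContMDiff I 𝓘(ℝ, Fin N → ℝ) ω ι ∧ Injective ι)
    (hS : ∀ {E : Type u} [NormedAddCommGroup E] [NormedSpace ℝ E] [FiniteDimensional ℝ E]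
      {H : Type v} [TopologicalSpace H] (I : ModelWithCorners ℝ E H) [I.Boundaryless]
      {M : Type w} [TopologicalSpace M] [ChartedSpace H M] [IsManifold I ω M]
      [CompactSpace M] [T2Space M] [ConnectedSpace M]
      (g : PseudoRiemannianMetric I ω E (TangentSpace I : M → Type _)) (hg : g.IsRiemannian)
      (p : M), IsManifoldSubanalytic I (cutLocus g hg p)) :
    buchner1977_cutLocus_triangulable.{u, v, w} := by
  refine buchner1977_cutLocus_triangulable_of_subanalytic_image hT ?_
  intro E _ _ _ H _ I _ M _ _ _ _ _ _ g hg p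
  obtain ⟨N, ι, hι, hinj⟩ := hG I M
  exact ⟨N, ι, hι.continuous, hinj, (hS I g hg p).isSubanalytic_image hι hinj⟩

end Literature.Geometry.Riemannian

end
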